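import Mathlib
import Summits.Ventures.FusionMHD.Models.CerfonFreidbergNstxLikeQHalfGGJHalf
import Summits.Ventures.FusionMHD.Models.FluxSurfacePolarRayLevelForceBalance
import Summits.Ventures.FusionMHD.Models.FluxSurfacePolarRayDivergence
import HarnessLib

/-!
# Ventures/FusionMHD — Models/CerfonFreidbergNstxLikeQHalfForceBalance.lean: AMPÈRE'S LAW and the SURFACE-AVERAGED FORCE BALANCE
# on the surface `ψ_N = 1/2` (and every nearby level) of THE Cerfon–Freidberg NSTX-like flux, discharged from `C²` regularity; hence
# the printed Glasser–Greene–Johnson ideal index `D_I` of that surface in the six registers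

HONEST FRAMING (LADDER-GRIDFUSION three columns; CF rung, F2 item R2; «F2.R2-POLAR-GGJ-DATA» instance part 3, LOW, no count).
Generic inputs (model-7): `Models/FluxSurfacePolarRayAmpere.lean` (Green by hand), `…LevelForceBalance.lean`
(`LevelLoop.ggjData_isForceBalanced`, `ggjDI_ggjData_eq_registerForm`), `…Divergence.lean` (fields from `C²`); instance inputs:
`…QHalfLevel.levelLoop` («F2.CF-Q-INTERIOR-NSTX» with level margins), `…QHalfGGJ` (`QHalf.ggjData`, `Gfield`), Literature `contDiffOn_cfSolution`,
`CFIterLike.gsOperator_of_isInstance` (`Δ*CFNstxLike.U = X²`).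
* CERTIFIED (kernel; this file + imports, axioms standard): for THE flux `CFNstxLike.U = cfSolution 0 coeff` (C^∞ on `X > 0`, `Δ*CFNstxLike.U = X²`) about
  its axis `(X_a, 0)` and EVERY level `u` with `|u − u₀| < 10⁻¹²`: (§1) the tangential field `k = tanField` and the divergence
  primitive of the closed-form radial field `Dfield` (`= radField` where `X > 0`) on `ℝ × [0, 1]`; (§2) **`toroidalCurrentE_eq_torVolume`**:
  `μ₀I(u) = ∮B_p dℓ = V(u)/2π` on the glued loop (Freidberg (6.27); `C = 1`); **`ggjData_isForceBalanced`**: the (8.134) record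
  `QHalf.ggjData F u` satisfies `p′V′ + I′Ψ′ − K′Φ′ = 0`; (§3) **`ggjDI_eq_registerForm`**: the PRINTED GGJ ideal index of the
  volume/Hamada-relabelled record (Zheng (2.62)) is `−mercierRegisterForm F 1 Pd Wd Aσ As AB Ai/(4F²Pd²)` in the six θ-integral
  registers (for `F ≠ 0`, shear `Pd ≠ 0`, `⟨B²/G⟩ ≠ 0` — the last two are hypotheses here, not computed in this cell for the NSTX-like surface).
* VALIDATED: nothing used.
* MODELLED: analytic Cerfon–Freidberg family, ideal MHD, Solov'ev profiles `C = 1`; statements about MODEL surfaces — never a device.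
Typer/prover: gridfusion-model-7 (g6; NSTX-like twin = the ITER-like text with the NSTX-like objects), 2026-08-27.  Citations: Freidberg 2014 (6.27), (6.153) [Freidberg2014]; Jardin 2010 (8.134)
[Jardin2010]; Zheng 2015 (2.62) [Zheng2015].
-/

noncomputable section

open Set MeasureTheory intervalIntegral Filter Topology
open Literature.MathematicalPhysics.MHD Literature.MathematicalPhysics.MHD.CerfonFreidberg Literature.MathematicalPhysics.MHD.GradShafranov
  Literature.MathematicalPhysics.MHD.FluxGeometry Literature.MathematicalPhysics.MHD.Mercier.FluxForm
open Summit.Ventures.FusionMHD.Models.PolarRay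

namespace Summit.Ventures.FusionMHD.Models.CFNstxLike.QHalf

/-! ## §1 The flux is `C²` on `X > 0`; rays with `s ∈ [0, 1]` stay there; fields -/

/-- THE flux, uncurried. -/
def Uxy : ℝ × ℝ → ℝ := fun p => CFNstxLike.U p.1 p.2

/-- The right half plane `X > 0`. -/
def ΩX : Set (ℝ × ℝ) := {p | 0 < p.1}

/-- `X > 0` is open. -/
theorem isOpen_ΩX : IsOpen CFNstxLike.QHalf.ΩX := isOpen_lt continuous_const continuous_fst

/-- `CFNstxLike.U` is `C²` (indeed `C^∞`) on `X > 0`. [cite: Freidberg2014, §6.6.1 eq. (6.153)] -/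
theorem contDiffOn_Uxy : ContDiffOn ℝ 2 CFNstxLike.QHalf.Uxy ΩX := contDiffOn_cfSolution 0 coeff

/-- Rays from the axis with `s ∈ [0, 1]` have `X = X_a + s cos θ > 0` (`X_a > 1.268`). -/
theorem ray_X_pos (θ : ℝ) {s : ℝ} (hs : s ∈ Icc (0 : ℝ) 1) : 0 < CFNstxLike.Xa + s * Real.cos θ := by
  have hXa := Xa_bounds.1
  have hc := Real.neg_one_le_cos θ
  nlinarith [hs.1, hs.2]

/-- … hence stay in `ΩX`. -/
theorem ray_mem (θ : ℝ) {s : ℝ} (hs : s ∈ Icc (0 : ℝ) 1) : rayPoint CFNstxLike.Xa 0 θ s ∈ ΩX := ray_X_pos θ hs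

/-- The closed-form radial field IS the Fréchet radial field where `X > 0`: `Dfield θ s = radField Uxy X_a 0 θ s`. -/
theorem Dfield_eq_radField {θ s : ℝ} (hX : 0 < CFNstxLike.Xa + s * Real.cos θ) : Dfield θ s = radField Uxy CFNstxLike.Xa 0 θ s := by
  have hψ : HasFDerivAt (fun q : ℝ × ℝ => CFNstxLike.U q.1 q.2) (fderiv ℝ Uxy (rayPoint CFNstxLike.Xa 0 θ s)) (CFNstxLike.Xa + s * Real.cos θ, 0 + s * Real.sin θ) :=
    hasFDerivAt_of_contDiffOn isOpen_ΩX contDiffOn_Uxy (p := rayPoint CFNstxLike.Xa 0 θ s) hX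
  obtain ⟨h1, h2⟩ := dR_dZ_of_hasFDerivAt hψ
  rw [radField_eq_radialDeriv, ← h1, ← h2, dR_U_eq hX.ne', dZ_U_eq, zero_add]
  rfl

/-- The Grad–Shafranov equation of the instance in Fréchet form on `X > 0`: `d²U(e₁,e₁) + d²U(e₂,e₂) − dU(e₁)/X = 1·X²`. -/
theorem gs_fderiv {θ s : ℝ} (hX : 0 < CFNstxLike.Xa + s * Real.cos θ) :
    fderiv ℝ (fderiv ℝ Uxy) (rayPoint CFNstxLike.Xa 0 θ s) (1, 0) (1, 0) + fderiv ℝ (fderiv ℝ Uxy) (rayPoint CFNstxLike.Xa 0 θ s) (0, 1) (0, 1)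
      - fderiv ℝ Uxy (rayPoint CFNstxLike.Xa 0 θ s) (1, 0) / (CFNstxLike.Xa + s * Real.cos θ) = 1 * (CFNstxLike.Xa + s * Real.cos θ) ^ 2 := by
  have h := gsOperator_eq_fderiv isOpen_ΩX contDiffOn_Uxy (R := CFNstxLike.Xa + s * Real.cos θ) (Z := 0 + s * Real.sin θ) hX hX.ne'
  have hgs : gsOperator (fun r z => Uxy (r, z)) (CFNstxLike.Xa + s * Real.cos θ) (0 + s * Real.sin θ) = (CFNstxLike.Xa + s * Real.cos θ) ^ 2 :=
    gsOperator_of_isInstance isInstance_U _ hX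
  rw [hgs] at h
  rw [one_mul]
  show _ = (CFNstxLike.Xa + s * Real.cos θ) ^ 2
  rw [h]
  unfold rayPoint
  ring

/-- THE DIVERGENCE PRIMITIVE of the instance on `ℝ × [0, 1]`: `∂_s(s·Dfield/X) = s·X − ∂_θ tanField`. -/
theorem hasDerivAt_divPrim (θ : ℝ) {σ : ℝ} (hσ : σ ∈ Icc (0 : ℝ) 1) :
    HasDerivAt (fun s => s * Dfield θ s / (CFNstxLike.Xa + s * Real.cos θ))
      (1 * σ * (CFNstxLike.Xa + σ * Real.cos θ) - tanFieldθ Uxy CFNstxLike.Xa 0 θ σ) σ := by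
  have hX := ray_X_pos θ hσ
  have h := hasDerivAt_divergencePrimitive (Rc := CFNstxLike.Xa) (Zc := 0) isOpen_ΩX contDiffOn_Uxy (ray_mem θ hσ) hX.ne' (gs_fderiv hX)
  refine h.congr_of_eventuallyEq ?_
  have hopen : ∀ᶠ s in 𝓝 σ, 0 < CFNstxLike.Xa + s * Real.cos θ :=
    (by fun_prop : Continuous fun s : ℝ => CFNstxLike.Xa + s * Real.cos θ).continuousAt.eventually (lt_mem_nhds hX)
  filter_upwards [hopen] with s hs
  rw [Dfield_eq_radField hs]

/-! ## §2 Ampère's law and the force balance at every level near `ψ_N = 1/2` -/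

/-- The gradient-squared field in Fréchet form (for continuity; equals `Gfield` where `X > 0`). -/
def GfieldF (θ s : ℝ) : ℝ :=
  (fderiv ℝ Uxy (rayPoint CFNstxLike.Xa 0 θ s) (1, 0)) ^ 2 + (fderiv ℝ Uxy (rayPoint CFNstxLike.Xa 0 θ s) (0, 1)) ^ 2

/-- The brackets lie in `[0, 1]`: for `k < 64`, `σ₂ k ≤ 1` and box radii are in `[0, 1]`. -/
theorem box_sub {k : ℕ} (hk : k < 64) {s : ℝ} (hs : s ∈ Icc (CFNstxLike.QHalf.σ₁ k) (σ₂ k)) : s ∈ Icc (0 : ℝ) 1 :=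
  ⟨(σ_bounds hk).1.le.trans hs.1, hs.2.trans (σ_bounds hk).2.le⟩

/-- The hypotheses of the generic force-balance theorem, discharged for the instance (smax = 1, C = 1, k = tanField). -/
theorem fb_hyps :
    (∀ k < 64, ∀ θ ∈ Icc (t64 k) (t64 (k + 1)), ∀ s ∈ Icc (σ₁ k) (σ₂ k), (Lray θ s (1, 0)) ^ 2 + (Lray θ s (0, 1)) ^ 2 = GfieldF θ s)
    ∧ (∀ k < 64, ContinuousOn (fun p : ℝ × ℝ => GfieldF p.1 p.2) (Icc (t64 k) (t64 (k + 1)) ×ˢ Icc (σ₁ k) (σ₂ k)))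
    ∧ (∀ k < 64, σ₂ k ≤ (1 : ℝ))
    ∧ (∀ k < 64, ∀ θ ∈ Icc (t64 k) (t64 (k + 1)), ∀ s ∈ Icc (σ₁ k) (σ₂ k),
        tanField Uxy CFNstxLike.Xa 0 θ s * (CFNstxLike.Xa + s * Real.cos θ) = tangentialDeriv (Lray θ s (1, 0)) (Lray θ s (0, 1)) θ)
    ∧ ContinuousOn (fun p : ℝ × ℝ => tanField Uxy CFNstxLike.Xa 0 p.1 p.2) (univ ×ˢ Icc 0 1)
    ∧ ContinuousOn (fun p : ℝ × ℝ => tanFieldθ Uxy CFNstxLike.Xa 0 p.1 p.2) (univ ×ˢ Icc 0 1)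
    ∧ (∀ θ : ℝ, ∀ σ ∈ Icc (0 : ℝ) 1, HasDerivAt (fun θ' => tanField Uxy CFNstxLike.Xa 0 θ' σ) (tanFieldθ Uxy CFNstxLike.Xa 0 θ σ) θ)
    ∧ (∀ σ : ℝ, tanField Uxy CFNstxLike.Xa 0 (2 * Real.pi) σ = tanField Uxy CFNstxLike.Xa 0 0 σ)
    ∧ (∀ θ : ℝ, ∀ σ ∈ Icc (0 : ℝ) 1, HasDerivAt (fun s => s * Dfield θ s / (CFNstxLike.Xa + s * Real.cos θ))
        (1 * σ * (CFNstxLike.Xa + σ * Real.cos θ) - tanFieldθ Uxy CFNstxLike.Xa 0 θ σ) σ) := by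
  have hK1 : ∀ p ∈ (univ : Set ℝ) ×ˢ Icc (0 : ℝ) 1, rayPoint CFNstxLike.Xa 0 p.1 p.2 ∈ ΩX := fun p hp => ray_mem p.1 hp.2
  have hR1 : ∀ p ∈ (univ : Set ℝ) ×ˢ Icc (0 : ℝ) 1, CFNstxLike.Xa + p.2 * Real.cos p.1 ≠ 0 := fun p hp => (ray_X_pos p.1 hp.2).ne'
  refine ⟨fun k hk θ hθ s hs => rfl, fun k hk => ?_, fun k hk => (σ_bounds hk).2.le, fun k hk θ hθ s hs => ?_, ?_, ?_, ?_, ?_, ?_⟩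
  · have hK : ∀ p ∈ Icc (t64 k) (t64 (k + 1)) ×ˢ Icc (σ₁ k) (σ₂ k), rayPoint CFNstxLike.Xa 0 p.1 p.2 ∈ ΩX :=
      fun p hp => ray_mem p.1 (box_sub hk hp.2)
    have hL : ContinuousOn (fun p : ℝ × ℝ => fderiv ℝ Uxy (rayPoint CFNstxLike.Xa 0 p.1 p.2)) (Icc (t64 k) (t64 (k + 1)) ×ˢ Icc (σ₁ k) (σ₂ k)) :=
      (contDiffOn_Uxy.continuousOn_fderiv_of_isOpen isOpen_ΩX (by norm_num)).comp
        (continuous_rayPoint_uncurry CFNstxLike.Xa 0).continuousOn hK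
    unfold GfieldF
    exact ((hL.clm_apply continuousOn_const).pow 2).add ((hL.clm_apply continuousOn_const).pow 2)
  · exact tanField_mul_eq_tangentialDeriv Uxy CFNstxLike.Xa 0 θ (ray_X_pos θ (box_sub hk hs)).ne'
  · exact continuousOn_tanField isOpen_ΩX contDiffOn_Uxy hK1 hR1
  · exact continuousOn_tanFieldθ isOpen_ΩX contDiffOn_Uxy hK1 hR1
  · exact fun θ σ hσ => hasDerivAt_tanField_theta isOpen_ΩX contDiffOn_Uxy (ray_mem θ hσ) (ray_X_pos θ hσ).ne'
  · intro σ; rw [← tanField_periodic Uxy CFNstxLike.Xa 0 0 σ, zero_add]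
  · exact fun θ σ hσ => hasDerivAt_divPrim θ hσ

section levels

variable {u : ℝ} (hu : u ∈ Ioo (u₀ - ((δQ : ℚ) : ℝ)) (u₀ + ((δQ : ℚ) : ℝ)))
include hu

/-- **AMPÈRE'S LAW ON THE SURFACE `CFNstxLike.U = u`** (`|u − u₀| < 10⁻¹²`): `μ₀I(u) = ∮ B_p dℓ = V(u)/2π` — Freidberg's (6.27) loop integral over
the glued polar loop equals `1/(2πμ₀)` times the enclosed volume `torVolume` (`Δ*CFNstxLike.U = X²`, `C = 1`). [cite: Freidberg2014, §6.3.3 eq. (6.27)] -/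
theorem toroidalCurrentE_eq_torVolume (μ0 : ℝ) :
    toroidalCurrentE μ0 CFNstxLike.U (loop CFNstxLike.Xa 0 (rayRadius CFNstxLike.U CFNstxLike.Xa 0 u)) (2 * Real.pi) = 1 / μ0 * (1 / (2 * Real.pi) * torVolume CFNstxLike.U CFNstxLike.Xa 0 u) := by
  obtain ⟨hG, hGc, hσ, hk, hkc, hkθc, hkθ, hkper, hm⟩ := fb_hyps
  exact levelLoop.toroidalCurrentE_eq_torVolume μ0 box_facts.1 box_facts.2 hG hGc hσ hk hkc hkθc hkθ hkper hm hu

/-- **THE SURFACE-AVERAGED FORCE BALANCE HOLDS for the (8.134) record of the surface `CFNstxLike.U = u`**: `(ggjData F u).IsForceBalanced`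
(`p′V′ + I′Ψ′ − K′Φ′ = 0`, i.e. `I′ = V′/2π`). [cite: Jardin2010, §8.5.4 eq. (8.134)] -/
theorem ggjData_isForceBalanced (F : ℝ) : (CFNstxLike.QHalf.ggjData F u).IsForceBalanced := by
  obtain ⟨hG, hGc, hσ, hk, hkc, hkθc, hkθ, hkper, hm⟩ := fb_hyps
  exact levelLoop.ggjData_isForceBalanced F box_facts.1 box_facts.2 hG hGc hσ hk hkc hkθc hkθ hkper hm hu

/-- **THE PRINTED GGJ IDEAL INDEX `D_I` OF THE SURFACE `CFNstxLike.U = u` IN SIX REGISTERS**: for the volume (Hamada) relabelling of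
`ggjData F u` and any `⟨σB²⟩`, `⟨B²⟩` inputs, `D_I = −mercierRegisterForm F 1 Pd Wd Aσ As AB Ai/(4F²Pd²)` with the six θ-integrals of
`mercierCriterion_iff` (fields `Dfield`, `F2field`, `Gfield`); hypotheses `F ≠ 0`, `Pd ≠ 0` (shear), `⟨B²/G⟩ ≠ 0`.
[cite: Zheng2015, §2.3 eq. (2.62)] -/
theorem ggjDI_eq_registerForm (F : ℝ) (hF : F ≠ 0)
    (hPd : (∫ θ in (0 : ℝ)..(2 * Real.pi),
      polarKernelDs CFNstxLike.Xa Dfield F2field θ (rayRadius CFNstxLike.U CFNstxLike.Xa 0 u θ) / Dfield θ (rayRadius CFNstxLike.U CFNstxLike.Xa 0 u θ)) ≠ 0)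
    (hAB : (ggjData F u).gB2 ≠ 0) (sB2 B2 : ℝ) :
    ((ggjData F u).relabel (ggjData F u).V' (ggjData F u).V'').ggjDI sB2 B2
      = -(mercierRegisterForm F 1
          (∫ θ in (0 : ℝ)..(2 * Real.pi), polarKernelDs CFNstxLike.Xa Dfield F2field θ (rayRadius CFNstxLike.U CFNstxLike.Xa 0 u θ) / Dfield θ (rayRadius CFNstxLike.U CFNstxLike.Xa 0 u θ))
          (∫ θ in (0 : ℝ)..(2 * Real.pi), volKernelDs CFNstxLike.Xa Dfield F2field θ (rayRadius CFNstxLike.U CFNstxLike.Xa 0 u θ) / Dfield θ (rayRadius CFNstxLike.U CFNstxLike.Xa 0 u θ))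
          (∫ θ in (0 : ℝ)..(2 * Real.pi), invGradKernel CFNstxLike.Xa Dfield Gfield θ (rayRadius CFNstxLike.U CFNstxLike.Xa 0 u θ))
          (∫ θ in (0 : ℝ)..(2 * Real.pi), sigmaSqKernel F CFNstxLike.Xa Dfield Gfield θ (rayRadius CFNstxLike.U CFNstxLike.Xa 0 u θ))
          (∫ θ in (0 : ℝ)..(2 * Real.pi), bsqGradKernel F CFNstxLike.Xa Dfield Gfield θ (rayRadius CFNstxLike.U CFNstxLike.Xa 0 u θ))
          (∫ θ in (0 : ℝ)..(2 * Real.pi), invBsqKernel F CFNstxLike.Xa Dfield Gfield θ (rayRadius CFNstxLike.U CFNstxLike.Xa 0 u θ)))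
        / (4 * F ^ 2 * (∫ θ in (0 : ℝ)..(2 * Real.pi),
            polarKernelDs CFNstxLike.Xa Dfield F2field θ (rayRadius CFNstxLike.U CFNstxLike.Xa 0 u θ) / Dfield θ (rayRadius CFNstxLike.U CFNstxLike.Xa 0 u θ)) ^ 2) := by
  obtain ⟨-, -, hσ, hk, hkc, hkθc, hkθ, hkper, hm⟩ := fb_hyps
  -- the force-balance hypotheses use `GfieldF`; the register kernels use the closed-form `Gfield` — both are admissible `G`s
  have hGc' : ∀ k < 64, ContinuousOn (fun p : ℝ × ℝ => Gfield p.1 p.2) (Icc (t64 k) (t64 (k + 1)) ×ˢ Icc (σ₁ k) (σ₂ k)) := by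
    intro k hk
    have hK : ∀ p ∈ Icc (t64 k) (t64 (k + 1)) ×ˢ Icc (σ₁ k) (σ₂ k), rayPoint CFNstxLike.Xa 0 p.1 p.2 ∈ ΩX :=
      fun p hp => ray_mem p.1 (box_sub hk hp.2)
    have hL : ContinuousOn (fun p : ℝ × ℝ => fderiv ℝ Uxy (rayPoint CFNstxLike.Xa 0 p.1 p.2)) (Icc (t64 k) (t64 (k + 1)) ×ˢ Icc (σ₁ k) (σ₂ k)) :=
      (contDiffOn_Uxy.continuousOn_fderiv_of_isOpen isOpen_ΩX (by norm_num)).comp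
        (continuous_rayPoint_uncurry CFNstxLike.Xa 0).continuousOn hK
    have hF2 : ContinuousOn (fun p : ℝ × ℝ => GfieldF p.1 p.2) (Icc (t64 k) (t64 (k + 1)) ×ˢ Icc (σ₁ k) (σ₂ k)) := by
      unfold GfieldF
      exact ((hL.clm_apply continuousOn_const).pow 2).add ((hL.clm_apply continuousOn_const).pow 2)
    refine hF2.congr fun p hp => ?_
    show Gfield p.1 p.2 = GfieldF p.1 p.2
    rw [← box_factsG k hk p.1 hp.1 p.2 hp.2]
    rfl
  exact levelLoop.ggjDI_ggjData_eq_registerForm F box_facts.1 box_facts.2 box_facts₂.1 box_facts₂.2 box_factsG hGc' box_factsGS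
    hσ hk hkc hkθc hkθ hkper hm hu hF hPd hAB sB2 B2

end levels

/-- **AT `ψ_N = 1/2` ITSELF**: `μ₀I = V/2π` on the NSTX-like chain's glued loop and the force balance of `ggjData F u₀`. [cite: Freidberg2014, §6.3.3 eq. (6.27)] -/
theorem forceBalance_half (F : ℝ) :
    toroidalCurrentE 1 CFNstxLike.U (loop CFNstxLike.Xa 0 ρ) (2 * Real.pi) = 1 / (2 * Real.pi) * torVolume CFNstxLike.U CFNstxLike.Xa 0 u₀ ∧ (ggjData F u₀).IsForceBalanced := by
  refine ⟨?_, ggjData_isForceBalanced u₀_mem F⟩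
  have h := toroidalCurrentE_eq_torVolume u₀_mem 1
  rw [one_div_one, one_mul] at h
  exact h

end Summit.Ventures.FusionMHD.Models.CFNstxLike.QHalf

end
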